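import Mathlib
import Literature.MathematicalPhysics.QuantumFieldTheory.Balaban1983to89.B9Eq325Proj

/-! # `Balaban1983to89.B9Thm311Data` — B9 Theorem 3.11, p. 416: "obvious for the first three operators" — Δ′_a, G′,
(Q′G′²Q′\*)⁻¹ positive definite, and the EXISTENCE (and uniqueness) of the (3.25) data of `B9Eq325Proj`, kernel-checked

CITATION HEADER.  Paper sub-cell `b2b-balaban-b09` (gen 6, journal claim SHARPEN T06.1 Thm 3.11 «obvious for the first
three operators» pass 9 ∕ C-B9-30-DATA, cell pub-balaban) on T. Balaban, *Propagators for lattice gauge theories in a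
background field*, Commun. Math. Phys. 99 (1985) 389–434 [`Balaban1985BackgroundPropagators`] (= B9), p. 394 [PDF 6]
and Theorem 3.11, p. 416 [PDF 28] (renders `b2b-balaban-ref1/pages/1985-cmp99-background-propagators/…-p006-x2.png`,
`…-p028-x2.png`), and on [3] = T. Bałaban, *Propagators and renormalization transformations for lattice gauge
theories. I*, Commun. Math. Phys. 95 (1984) 17–40 [`Balaban1984PropagatorsI`] (= B5), p. 25 [PDF 9] (render
`…/1984-cmp95-propagators-rt-I/…-p009-x2.png`); all read as images this session.

WHAT IS PRINTED (verbatim).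
* B9 p. 394: *"Let us introduce the operator Δ′_a = Δ′_a(U) = (Δ^η_U + Q′\*aQ′)↾_{Ω₀}, where Q′\*aQ′ is defined by the
  same quadratic form as in (2.14), i.e. ⟨λ, Q′\*aQ′λ⟩ = Σ_{j=0}^{k} a_j Σ_{y∈Λ_j} (L^jη)^{d−2}|(Q′_j(U)λ)(y)|², (3.24) the
  numbers a_j satisfy the recursive equations a_{j+1} = aa_j/(aL^{−2} + a_j), a₁ = a₀ = a > 0. … Its inverse is denoted
  by G′, or G′(U)."* … *"Rf = (I − G′Q′\*(Q′G′²Q′\*)^{−1}Q′G′)f, (3.25) where G′ = G′(U) = (Δ′_a)^{−1}. We do not know yet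
  if the operators in the above"* [formula are well defined].
* B9 p. 416, Theorem 3.11: *"Under the assumptions of the Theorems 3.1–3.10 (i.e. for M sufficiently large and α₀
  sufficiently small) the operators Δ′_a, G′, (Q′G′²Q′\*)^{−1}, Δ_a, G are positive definite."*  Proof, first
  sentence: *"This is obvious for the first three operators, and also for P and R, hence it is enough to prove it for
  G. It is a symmetric and invertible operator, so if it is not positive, then there exists A₀ ≠ 0, λ₀ > 0 such that
  GA₀ = −λ₀A₀."* (the G-argument that follows is kernel-checked in adv1's `B9Thm311`; it is disjoint from this file).
* B5 p. 25, after (1.44): *"Now all the operators appearing in these formulas are well defined. We have to verify it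
  only for (Q′_kG′_k²Q′\*_k)^{−1}. It is enough to prove that Q′_kG′_k²Q′\*_k is positive definite. This operator is of
  course nonnegative and if for some ω defined on T₁^{(k)} we have ⟨ω, Q′_kG′_k²Q′\*_kω⟩ = ‖G′_kQ′\*_kω‖² = 0, then
  Q′\*_kω = 0, hence ω = 0."*

WHY THIS FILE.  Passes 6–8 (`B9Eq325Proj`, `B9Eq333Cov`, `B9Eq320Gauss`) work under the hypothesis bundle
`B9Eq325Proj.Data Δ q qs A g c`, which only NAMES the inverses G′ and (Q′G′²Q′\*)^{−1} ("Existence is Theorem 3.11 and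
is NOT part of the bundle's content").  This file certifies the printed "obvious" clause of Theorem 3.11 at the same
abstraction and, in finite dimension (the lattice spaces are finite-dimensional), CONSTRUCTS the bundle: the named
inverses exist, are unique, symmetric and positive definite.  adv1's `B9Thm311` treats the non-obvious clause (G, via
(3.105)–(3.106)); no tree module constructs `Data`/`GreenData` (checked: `B5Projector144`, `B5Projection127`,
`B5Infimum124` take the inverses as hypotheses).

TYPING (as `B9Eq325Proj`).  `E` ⊇ L²(Ω₀, 𝔤), `F` = L²(𝔅) abstract real inner-product spaces; `Δ` = Δ^η_U↾Ω₀, `q` = Q′,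
`qs` = Q′\*, `A` = a (level-dependent, an operator on F), `lapA Δ q qs A` = Δ′_a.  `PosDef T` := ∀ x ≠ 0, 0 < ⟨x, Tx⟩ (the
meaning fixed by the printed proof: "symmetric and invertible … if it is not positive, then there exists A₀ ≠ 0, λ₀ > 0
such that GA₀ = −λ₀A₀").  THE INPUTS of "obvious", each a hypothesis named where used: Δ^η_U symmetric (`hΔ`, (3.23)
Δ^η_U = D\*D), Q′\* the adjoint of Q′ (`hadj`, p. 393 scalar products), a symmetric (`hA`); for Δ′_a > 0 EITHER the
hypothesis `hpos : PosDef (lapA Δ q qs A)` itself OR (`lapA_posDef_of`) its printed ingredients ⟨λ, Δ^η_U λ⟩ ≥ 0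
(= ‖D^η_U λ‖²), a > 0 (`PosDef A`: the a_j are positive numbers) and the lattice fact "D^η_U λ·λ = 0 ∧ Q′λ = 0 ⇒ λ = 0"
in the form `hker : ⟨λ, Δ^η_U λ⟩ = 0 → Q′λ = 0 → λ = 0` (Dirichlet restriction to Ω₀ / no covariantly-constant field
with vanishing block averages — NOT derived here); and Q′\* injective (`hqs`, B5 p. 25 "Q′\*_kω = 0, hence ω = 0"; for
the block averages (3.18)–(3.19) Q′Q′\* is block-diagonal and invertible — NOT derived here, cf. `B9Eq319Avg`).

WHAT THIS FILE CERTIFIES (kernel, zero sorry; [folklore] linear algebra; value = the "obvious" clause of Theorem 3.11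
made explicit and the hypothesis bundle of passes 6–8 DISCHARGED to its printed inputs, NOT summit progress).
1. §1 generic: `PosDef`; a positive definite operator is injective (`injective_of_posDef`), in finite dimension
   bijective (`bijective_of_posDef`) with a two-sided inverse `inv` (`inv_left`, `inv_right`) which is positive definite
   (`inv_posDef`) and symmetric when T is (`inv_symm`).
2. §2 Δ′_a: `inner_lapA` — the (3.24) quadratic form ⟨λ, Δ′_aλ⟩ = ⟨λ, Δ^η_U λ⟩ + ⟨Q′λ, aQ′λ⟩; `lapA_symm_of`;
   `lapA_posDef_of` — Δ′_a > 0 from the printed ingredients above ("obvious", operator 1).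
3. §3 for ANY `Data` bundle (dimension-free): `data_inner_qggqs` — B5 p. 25's identity ⟨ω, Q′G′²Q′\*ω⟩ = ‖G′Q′\*ω‖²;
   `data_g_posDef` — G′ > 0 from Δ′_a > 0 (operator 2); `data_qggqs_posDef`, `data_c_posDef` — Q′G′²Q′\* > 0 and
   (Q′G′²Q′\*)^{−1} > 0 from Q′\* injective, by exactly the printed B5 argument (operator 3); `data_g_unique`,
   `data_c_unique` — the named inverses are UNIQUE (two bundles over the same Δ, Q′, Q′\*, a have the same G′ and the
   same (Q′G′²Q′\*)^{−1}), so "Its inverse is denoted by G′" names a definite operator.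
4. §4 EXISTENCE in finite dimension: `gOf` := (Δ′_a)^{−1}, `cOf` := (Q′G′²Q′\*)^{−1} (via `inv`), `data_of_posDef :
   Data Δ q qs A gOf cOf`, `exists_data`, `exists_data_of_ingredients` — from (hΔ, hadj, hA, hpos | ingredients, hqs) the
   bundle EXISTS with G′, (Q′G′²Q′\*)^{−1} symmetric positive definite: "We do not know yet if the operators in the above
   formula are well defined" is settled at the linear-algebra level by Theorem 3.11's first sentence, as printed.
5. §5 consequence for passes 6/8: `exists_proj` — under the same inputs there are G′, (Q′G′²Q′\*)^{−1} for which the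
   (3.25) operator R IS Mathlib's orthogonal projection onto Δ^η_U N(Q′) (`B9Eq325Proj.Data.R325_eq_starProjection_fd`),
   i.e. (3.20)–(3.25) hold unconditionally on finite-dimensional E, F given the printed inputs.
NOT HERE: the lattice facts behind `hker` / `hpos` and `hqs` (Dirichlet covariant Laplacian, block-averaging
surjectivity), the quantitative bounds of Theorems 3.1–3.10 (uniform positivity constants, decay), the clauses Δ_a, G
of Theorem 3.11 (adv1 `B9Thm311`), P and R ("also for P and R": R is pass 6's orthogonal projection `R325_symm`/
`R325_idem`, hence ≥ 0 — not restated).  Cell records: GAPS C-B9-30, DIVERGENCE D-b09.21. -/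

namespace Literature.MathematicalPhysics.QuantumFieldTheory.Balaban1983to89.B9Thm311Data

open B5Projector144 B9Eq325Proj

variable {E F : Type*} [NormedAddCommGroup E] [InnerProductSpace ℝ E] [NormedAddCommGroup F]
  [InnerProductSpace ℝ F]

/-! ## §1  Positive definite operators and their inverses (generic) -/

/-- "positive definite" in the sense fixed by the printed proof of Theorem 3.11 (symmetric operators with
⟨x, Tx⟩ > 0 for x ≠ 0; symmetry is kept as a separate hypothesis where needed). [cite: Balaban1985BackgroundPropagators, Thm 3.11 p.416] -/
def PosDef {V : Type*} [NormedAddCommGroup V] [InnerProductSpace ℝ V] (T : V →ₗ[ℝ] V) : Prop :=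
  ∀ x : V, x ≠ 0 → 0 < inner ℝ x (T x)

section Generic

variable {V : Type*} [NormedAddCommGroup V] [InnerProductSpace ℝ V]

/-- A positive definite operator is non-negative. [folklore] -/
theorem nonneg_of_posDef {T : V →ₗ[ℝ] V} (hT : PosDef T) (x : V) : 0 ≤ inner ℝ x (T x) := by
  by_cases hx : x = 0
  · rw [hx, inner_zero_left]
  · exact (hT x hx).le

/-- A positive definite operator is injective. [folklore] -/
theorem injective_of_posDef {T : V →ₗ[ℝ] V} (hT : PosDef T) : Function.Injective T := by
  intro x y hxy
  by_contra hne
  have h := hT (x - y) (sub_ne_zero.mpr hne)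
  rw [map_sub, hxy, sub_self, inner_zero_right] at h
  exact lt_irrefl 0 h

/-- ⟨x, Tx⟩ = 0 forces x = 0 for a positive definite T. [folklore] -/
theorem eq_zero_of_inner_eq_zero {T : V →ₗ[ℝ] V} (hT : PosDef T) (x : V) (hx : inner ℝ x (T x) = 0) : x = 0 := by
  by_contra hne
  have h := hT x hne
  rw [hx] at h
  exact lt_irrefl 0 h

variable [FiniteDimensional ℝ V]

/-- In finite dimension a positive definite operator is bijective. [folklore] -/
theorem bijective_of_posDef {T : V →ₗ[ℝ] V} (hT : PosDef T) : Function.Bijective T :=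
  ⟨injective_of_posDef hT, LinearMap.injective_iff_surjective.mp (injective_of_posDef hT)⟩

/-- The inverse of a positive definite operator (finite dimension), as a linear map. [folklore] -/
noncomputable def inv (T : V →ₗ[ℝ] V) (hT : PosDef T) : V →ₗ[ℝ] V :=
  ((LinearEquiv.ofBijective T (bijective_of_posDef hT)).symm : V →ₗ[ℝ] V)

/-- `inv T` is a left inverse: T^{−1}(Tx) = x. [folklore] -/
theorem inv_left {T : V →ₗ[ℝ] V} (hT : PosDef T) (x : V) : inv T hT (T x) = x := by
  unfold inv
  rw [LinearEquiv.coe_coe, LinearEquiv.symm_apply_eq, LinearEquiv.ofBijective_apply]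

/-- `inv T` is a right inverse: T(T^{−1}y) = y. [folklore] -/
theorem inv_right {T : V →ₗ[ℝ] V} (hT : PosDef T) (y : V) : T (inv T hT y) = y := by
  unfold inv
  rw [LinearEquiv.coe_coe]
  have h := (LinearEquiv.ofBijective T (bijective_of_posDef hT)).apply_symm_apply y
  rwa [LinearEquiv.ofBijective_apply] at h

/-- The inverse of a positive definite operator is positive definite. [folklore] -/
theorem inv_posDef {T : V →ₗ[ℝ] V} (hT : PosDef T) : PosDef (inv T hT) := by
  intro y hy
  have hx : inv T hT y ≠ 0 := by
    intro h0
    apply hy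
    rw [← inv_right hT y, h0, map_zero]
  have h := hT (inv T hT y) hx
  rwa [inv_right hT y, real_inner_comm] at h

/-- The inverse of a symmetric positive definite operator is symmetric. [folklore] -/
theorem inv_symm {T : V →ₗ[ℝ] V} (hT : PosDef T) (hsymm : ∀ x y : V, inner ℝ (T x) y = inner ℝ x (T y))
    (y y' : V) : inner ℝ (inv T hT y) y' = inner ℝ y (inv T hT y') := by
  conv_lhs => rw [← inv_right hT y']
  conv_rhs => rw [← inv_right hT y]
  rw [← hsymm]

end Generic

/-! ## §2  Δ′_a: the (3.24) quadratic form, symmetry, positivity ("obvious", operator 1) -/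

section LapA

variable (Δ : E →ₗ[ℝ] E) (q : E →ₗ[ℝ] F) (qs : F →ₗ[ℝ] E) (A : F →ₗ[ℝ] F)

/-- **(3.24)** as a quadratic-form identity: ⟨λ, Δ′_aλ⟩ = ⟨λ, Δ^η_U λ⟩ + ⟨Q′λ, a Q′λ⟩ (Q′\* the adjoint of Q′).
[cite: Balaban1985BackgroundPropagators, (3.24) p.394] -/
theorem inner_lapA (hadj : ∀ (x : E) (φ : F), inner ℝ (q x) φ = inner ℝ x (qs φ)) (x : E) :
    inner ℝ x (lapA Δ q qs A x) = inner ℝ x (Δ x) + inner ℝ (q x) (A (q x)) := by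
  rw [lapA_apply, inner_add_right, ← hadj]

/-- Δ′_a is symmetric (Δ^η_U symmetric, a symmetric, Q′\* adjoint to Q′) — without assuming any inverse.
[folklore] -/
theorem lapA_symm_of (hΔ : ∀ x y : E, inner ℝ (Δ x) y = inner ℝ x (Δ y))
    (hadj : ∀ (x : E) (φ : F), inner ℝ (q x) φ = inner ℝ x (qs φ))
    (hA : ∀ φ ψ : F, inner ℝ (A φ) ψ = inner ℝ φ (A ψ)) (x y : E) :
    inner ℝ (lapA Δ q qs A x) y = inner ℝ x (lapA Δ q qs A y) := by
  rw [lapA_apply, lapA_apply, inner_add_left, inner_add_right, hΔ, adj_symm hadj, hA, hadj]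

/-- **Δ′_a > 0 from its printed ingredients** ("obvious", operator 1): ⟨λ, Δ^η_U λ⟩ ≥ 0 (= ‖D^η_U λ‖² by (3.23)),
a > 0 (the a_j are positive numbers, (3.24)), and the lattice fact "⟨λ, Δ^η_U λ⟩ = 0 ∧ Q′λ = 0 ⇒ λ = 0" (`hker`,
hypothesis). [cite: Balaban1985BackgroundPropagators, (3.24) p.394, Thm 3.11 p.416] -/
theorem lapA_posDef_of (hadj : ∀ (x : E) (φ : F), inner ℝ (q x) φ = inner ℝ x (qs φ))
    (hΔnn : ∀ x : E, 0 ≤ inner ℝ x (Δ x)) (hApos : PosDef A)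
    (hker : ∀ x : E, inner ℝ x (Δ x) = 0 → q x = 0 → x = 0) : PosDef (lapA Δ q qs A) := by
  intro x hx
  rw [inner_lapA Δ q qs A hadj x]
  have h1 := hΔnn x
  have h2 := nonneg_of_posDef hApos (q x)
  rcases (add_nonneg h1 h2).lt_or_eq with hlt | heq
  · exact hlt
  · exfalso
    have h1' : inner ℝ x (Δ x) = 0 := le_antisymm (by linarith) h1
    have h2' : inner ℝ (q x) (A (q x)) = 0 := le_antisymm (by linarith) h2
    exact hx (hker x h1' (eq_zero_of_inner_eq_zero hApos (q x) h2'))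

end LapA

/-! ## §3  For ANY `Data` bundle: G′ > 0, Q′G′²Q′\* > 0, (Q′G′²Q′\*)⁻¹ > 0 ("obvious", operators 2–3); uniqueness -/

section OfData

variable {Δ : E →ₗ[ℝ] E} {q : E →ₗ[ℝ] F} {qs : F →ₗ[ℝ] E} {A : F →ₗ[ℝ] F} {g : E →ₗ[ℝ] E} {c : F →ₗ[ℝ] F}

/-- G′ is injective (it has the two-sided inverse Δ′_a). [folklore] -/
theorem data_g_injective (h : B9Eq325Proj.Data Δ q qs A g c) : Function.Injective g := by
  intro x y hxy
  rw [← h.g_right x, ← h.g_right y, hxy]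

/-- **G′ > 0** from Δ′_a > 0 ("obvious", operator 2): ⟨ω, G′ω⟩ = ⟨Δ′_aλ, λ⟩ with λ = G′ω ≠ 0. Dimension-free.
[cite: Balaban1985BackgroundPropagators, Thm 3.11 p.416] -/
theorem data_g_posDef (h : B9Eq325Proj.Data Δ q qs A g c) (hpos : PosDef (lapA Δ q qs A)) : PosDef g := by
  intro y hy
  have hx : g y ≠ 0 := by
    intro h0
    apply hy
    rw [← h.g_right y, h0, map_zero]
  have h1 := hpos (g y) hx
  rwa [h.g_right y, real_inner_comm] at h1

/-- **B5 p. 25's identity**: ⟨ω, Q′G′²Q′\*ω⟩ = ‖G′Q′\*ω‖² (G′ symmetric, Q′\* adjoint to Q′).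
[cite: Balaban1984PropagatorsI, p.25 (after (1.44))] -/
theorem data_inner_qggqs (h : B9Eq325Proj.Data Δ q qs A g c) (ω : F) :
    inner ℝ ω (q (g (g (qs ω)))) = ‖g (qs ω)‖ ^ 2 := by
  rw [← adj_symm h.adj, ← h.g_symm, real_inner_self_eq_norm_sq]

/-- **Q′G′²Q′\* > 0** ("This operator is of course nonnegative and if … ‖G′Q′\*ω‖² = 0, then Q′\*ω = 0, hence ω = 0"):
from Q′\* injective. Dimension-free. [cite: Balaban1984PropagatorsI, p.25; Balaban1985BackgroundPropagators, Thm 3.11 p.416] -/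
theorem data_qggqs_posDef (h : B9Eq325Proj.Data Δ q qs A g c) (hqs : Function.Injective qs) :
    PosDef (q ∘ₗ g ∘ₗ g ∘ₗ qs) := by
  intro ω hω
  simp only [LinearMap.comp_apply]
  rw [data_inner_qggqs h ω]
  have hne : g (qs ω) ≠ 0 := by
    intro h0
    apply hω
    apply hqs
    rw [map_zero]
    exact data_g_injective h (by rw [h0, map_zero])
  positivity

/-- **(Q′G′²Q′\*)^{−1} > 0** ("obvious", operator 3), for the bundle's named inverse `c`. Dimension-free.
[cite: Balaban1985BackgroundPropagators, Thm 3.11 p.416] -/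
theorem data_c_posDef (h : B9Eq325Proj.Data Δ q qs A g c) (hqs : Function.Injective qs) : PosDef c := by
  intro φ hφ
  have hψ : c φ ≠ 0 := by
    intro h0
    apply hφ
    rw [← h.c_right φ, h0, map_zero, map_zero, map_zero, map_zero]
  have h1 := data_qggqs_posDef h hqs (c φ) hψ
  simp only [LinearMap.comp_apply] at h1
  rwa [h.c_right φ, real_inner_comm] at h1

/-- UNIQUENESS of G′: two bundles over the same (Δ^η_U, Q′, Q′\*, a) have the same G′ ("Its inverse is denoted by G′"
names one operator). [folklore] -/
theorem data_g_unique {g' : E →ₗ[ℝ] E} {c' : F →ₗ[ℝ] F} (h : B9Eq325Proj.Data Δ q qs A g c)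
    (h' : B9Eq325Proj.Data Δ q qs A g' c') : g = g' := by
  ext y
  have h1 := h.g_left (g' y)
  rwa [h'.g_right y] at h1

/-- UNIQUENESS of (Q′G′²Q′\*)^{−1}. [folklore] -/
theorem data_c_unique {g' : E →ₗ[ℝ] E} {c' : F →ₗ[ℝ] F} (h : B9Eq325Proj.Data Δ q qs A g c)
    (h' : B9Eq325Proj.Data Δ q qs A g' c') : c = c' := by
  have hg : g = g' := data_g_unique h h'
  subst hg
  ext φ
  have h1 := h.c_left (c' φ)
  rwa [h'.c_right φ] at h1

end OfData

/-! ## §4  EXISTENCE of the (3.25) data in finite dimension -/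

section Existence

variable [FiniteDimensional ℝ E] (Δ : E →ₗ[ℝ] E) (q : E →ₗ[ℝ] F) (qs : F →ₗ[ℝ] E) (A : F →ₗ[ℝ] F)

/-- G′ := (Δ′_a)^{−1} (exists in finite dimension as soon as Δ′_a > 0). [cite: Balaban1985BackgroundPropagators, p.394 ("Its inverse is denoted by G′")] -/
noncomputable def gOf (hpos : PosDef (lapA Δ q qs A)) : E →ₗ[ℝ] E := inv (lapA Δ q qs A) hpos

variable {Δ q qs A}

/-- G′Δ′_a = I. [folklore] -/
theorem gOf_left (hpos : PosDef (lapA Δ q qs A)) (x : E) : gOf Δ q qs A hpos (lapA Δ q qs A x) = x :=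
  inv_left hpos x

/-- Δ′_aG′ = I. [folklore] -/
theorem gOf_right (hpos : PosDef (lapA Δ q qs A)) (y : E) : lapA Δ q qs A (gOf Δ q qs A hpos y) = y :=
  inv_right hpos y

/-- G′ is symmetric (Δ′_a symmetric). [folklore] -/
theorem gOf_symm (hpos : PosDef (lapA Δ q qs A)) (hΔ : ∀ x y : E, inner ℝ (Δ x) y = inner ℝ x (Δ y))
    (hadj : ∀ (x : E) (φ : F), inner ℝ (q x) φ = inner ℝ x (qs φ))
    (hA : ∀ φ ψ : F, inner ℝ (A φ) ψ = inner ℝ φ (A ψ)) (y y' : E) :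
    inner ℝ (gOf Δ q qs A hpos y) y' = inner ℝ y (gOf Δ q qs A hpos y') :=
  inv_symm hpos (lapA_symm_of Δ q qs A hΔ hadj hA) y y'

/-- B5 p. 25's identity for the constructed G′: ⟨ω, Q′G′²Q′\*ω⟩ = ‖G′Q′\*ω‖². [cite: Balaban1984PropagatorsI, p.25] -/
theorem inner_qggqs_of (hpos : PosDef (lapA Δ q qs A)) (hΔ : ∀ x y : E, inner ℝ (Δ x) y = inner ℝ x (Δ y))
    (hadj : ∀ (x : E) (φ : F), inner ℝ (q x) φ = inner ℝ x (qs φ))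
    (hA : ∀ φ ψ : F, inner ℝ (A φ) ψ = inner ℝ φ (A ψ)) (ω : F) :
    inner ℝ ω ((q ∘ₗ gOf Δ q qs A hpos ∘ₗ gOf Δ q qs A hpos ∘ₗ qs) ω) = ‖gOf Δ q qs A hpos (qs ω)‖ ^ 2 := by
  simp only [LinearMap.comp_apply]
  rw [← adj_symm hadj, ← gOf_symm hpos hΔ hadj hA, real_inner_self_eq_norm_sq]

/-- Q′G′²Q′\* > 0 for the constructed G′, from Q′\* injective (B5 p. 25's argument). [cite: Balaban1984PropagatorsI, p.25] -/
theorem qggqs_posDef_of (hpos : PosDef (lapA Δ q qs A)) (hΔ : ∀ x y : E, inner ℝ (Δ x) y = inner ℝ x (Δ y))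
    (hadj : ∀ (x : E) (φ : F), inner ℝ (q x) φ = inner ℝ x (qs φ))
    (hA : ∀ φ ψ : F, inner ℝ (A φ) ψ = inner ℝ φ (A ψ)) (hqs : Function.Injective qs) :
    PosDef (q ∘ₗ gOf Δ q qs A hpos ∘ₗ gOf Δ q qs A hpos ∘ₗ qs) := by
  intro ω hω
  rw [inner_qggqs_of hpos hΔ hadj hA ω]
  have hne : gOf Δ q qs A hpos (qs ω) ≠ 0 := by
    intro h0
    apply hω
    apply hqs
    rw [map_zero]
    exact injective_of_posDef (inv_posDef hpos) (by rw [map_zero]; exact h0)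
  positivity

variable [FiniteDimensional ℝ F]

/-- (Q′G′²Q′\*)^{−1} for the constructed G′ (exists in finite dimension). [cite: Balaban1985BackgroundPropagators, (3.25) p.394] -/
noncomputable def cOf (hpos : PosDef (lapA Δ q qs A)) (hΔ : ∀ x y : E, inner ℝ (Δ x) y = inner ℝ x (Δ y))
    (hadj : ∀ (x : E) (φ : F), inner ℝ (q x) φ = inner ℝ x (qs φ))
    (hA : ∀ φ ψ : F, inner ℝ (A φ) ψ = inner ℝ φ (A ψ)) (hqs : Function.Injective qs) : F →ₗ[ℝ] F :=
  inv (q ∘ₗ gOf Δ q qs A hpos ∘ₗ gOf Δ q qs A hpos ∘ₗ qs) (qggqs_posDef_of hpos hΔ hadj hA hqs)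

/-- **EXISTENCE OF THE (3.25) DATA** (finite dimension): from Δ^η_U symmetric, Q′\* adjoint to Q′, a symmetric,
Δ′_a > 0 and Q′\* injective, the constructed G′ = (Δ′_a)^{−1} and (Q′G′²Q′\*)^{−1} satisfy `B9Eq325Proj.Data` — the
hypothesis bundle of passes 6–8. [cite: Balaban1985BackgroundPropagators, Thm 3.11 p.416, (3.24)-(3.25) p.394] -/
theorem data_of_posDef (hpos : PosDef (lapA Δ q qs A)) (hΔ : ∀ x y : E, inner ℝ (Δ x) y = inner ℝ x (Δ y))
    (hadj : ∀ (x : E) (φ : F), inner ℝ (q x) φ = inner ℝ x (qs φ))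
    (hA : ∀ φ ψ : F, inner ℝ (A φ) ψ = inner ℝ φ (A ψ)) (hqs : Function.Injective qs) :
    B9Eq325Proj.Data Δ q qs A (gOf Δ q qs A hpos) (cOf hpos hΔ hadj hA hqs) where
  lap_symm := hΔ
  adj := hadj
  A_symm := hA
  g_left := gOf_left hpos
  g_right := gOf_right hpos
  c_left φ := by
    have h1 := inv_left (qggqs_posDef_of hpos hΔ hadj hA hqs) φ
    simp only [LinearMap.comp_apply] at h1
    exact h1
  c_right φ := by
    have h1 := inv_right (qggqs_posDef_of hpos hΔ hadj hA hqs) φ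
    simp only [LinearMap.comp_apply] at h1
    exact h1

/-- **THEOREM 3.11, "obvious for the first three operators"**, packaged with existence: under the printed inputs
there EXIST G′ and (Q′G′²Q′\*)^{−1} forming the (3.25) data, and Δ′_a, G′, (Q′G′²Q′\*)^{−1} are all symmetric positive
definite. [cite: Balaban1985BackgroundPropagators, Thm 3.11 p.416] -/
theorem exists_data (hpos : PosDef (lapA Δ q qs A)) (hΔ : ∀ x y : E, inner ℝ (Δ x) y = inner ℝ x (Δ y))
    (hadj : ∀ (x : E) (φ : F), inner ℝ (q x) φ = inner ℝ x (qs φ))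
    (hA : ∀ φ ψ : F, inner ℝ (A φ) ψ = inner ℝ φ (A ψ)) (hqs : Function.Injective qs) :
    ∃ (g : E →ₗ[ℝ] E) (c : F →ₗ[ℝ] F), B9Eq325Proj.Data Δ q qs A g c ∧ PosDef (lapA Δ q qs A) ∧ PosDef g ∧
      PosDef c ∧ (∀ x y : E, inner ℝ (g x) y = inner ℝ x (g y)) ∧ (∀ φ ψ : F, inner ℝ (c φ) ψ = inner ℝ φ (c ψ)) := by
  refine ⟨gOf Δ q qs A hpos, cOf hpos hΔ hadj hA hqs, data_of_posDef hpos hΔ hadj hA hqs, hpos,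
    data_g_posDef (data_of_posDef hpos hΔ hadj hA hqs) hpos,
    data_c_posDef (data_of_posDef hpos hΔ hadj hA hqs) hqs,
    (data_of_posDef hpos hΔ hadj hA hqs).g_symm, ?_⟩
  exact (data_of_posDef hpos hΔ hadj hA hqs).greenData.c_symm (data_of_posDef hpos hΔ hadj hA hqs).lapA_symm hadj

/-- The same from the printed INGREDIENTS of Δ′_a > 0 (⟨λ, Δ^η_U λ⟩ ≥ 0, a > 0, the kernel condition `hker`).
[cite: Balaban1985BackgroundPropagators, Thm 3.11 p.416, (3.24) p.394] -/
theorem exists_data_of_ingredients (hΔ : ∀ x y : E, inner ℝ (Δ x) y = inner ℝ x (Δ y))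
    (hadj : ∀ (x : E) (φ : F), inner ℝ (q x) φ = inner ℝ x (qs φ))
    (hA : ∀ φ ψ : F, inner ℝ (A φ) ψ = inner ℝ φ (A ψ)) (hΔnn : ∀ x : E, 0 ≤ inner ℝ x (Δ x)) (hApos : PosDef A)
    (hker : ∀ x : E, inner ℝ x (Δ x) = 0 → q x = 0 → x = 0) (hqs : Function.Injective qs) :
    ∃ (g : E →ₗ[ℝ] E) (c : F →ₗ[ℝ] F), B9Eq325Proj.Data Δ q qs A g c ∧ PosDef (lapA Δ q qs A) ∧ PosDef g ∧
      PosDef c ∧ (∀ x y : E, inner ℝ (g x) y = inner ℝ x (g y)) ∧ (∀ φ ψ : F, inner ℝ (c φ) ψ = inner ℝ φ (c ψ)) :=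
  exists_data (lapA_posDef_of Δ q qs A hadj hΔnn hApos hker) hΔ hadj hA hqs

end Existence

/-! ## §5  Consequence for (3.20)–(3.25): the projection statements hold unconditionally in finite dimension -/

section Consequence

variable [FiniteDimensional ℝ E] {Δ : E →ₗ[ℝ] E} {q : E →ₗ[ℝ] F} {qs : F →ₗ[ℝ] E} {A : F →ₗ[ℝ] F}

/-- R does not depend on WHICH inverses are used: any bundle over the same printed inputs gives the orthogonal
projection onto Δ^η_U N(Q′) (pass 6, restated for reference next to the existence result). [folklore] -/
theorem proj_of_any_data {g : E →ₗ[ℝ] E} {c : F →ₗ[ℝ] F} (h : B9Eq325Proj.Data Δ q qs A g c) (f : E) :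
    (lapKer Δ q).starProjection f = R325 q qs g c f :=
  h.R325_eq_starProjection_fd f

variable [FiniteDimensional ℝ F]

/-- Under the printed inputs (finite dimension) there exist G′, (Q′G′²Q′\*)^{−1} such that the (3.25) operator R IS
the orthogonal projection onto Δ^η_U N(Q′) — pass 6's conditional (3.21) made unconditional.
[cite: Balaban1985BackgroundPropagators, (3.21) p.394, (3.25) p.394, Thm 3.11 p.416] -/
theorem exists_proj (hpos : PosDef (lapA Δ q qs A)) (hΔ : ∀ x y : E, inner ℝ (Δ x) y = inner ℝ x (Δ y))
    (hadj : ∀ (x : E) (φ : F), inner ℝ (q x) φ = inner ℝ x (qs φ))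
    (hA : ∀ φ ψ : F, inner ℝ (A φ) ψ = inner ℝ φ (A ψ)) (hqs : Function.Injective qs) :
    ∃ (g : E →ₗ[ℝ] E) (c : F →ₗ[ℝ] F), B9Eq325Proj.Data Δ q qs A g c ∧
      ∀ f : E, (lapKer Δ q).starProjection f = R325 q qs g c f :=
  ⟨gOf Δ q qs A hpos, cOf hpos hΔ hadj hA hqs, data_of_posDef hpos hΔ hadj hA hqs,
    fun f => (data_of_posDef hpos hΔ hadj hA hqs).R325_eq_starProjection_fd f⟩

end Consequence

end Literature.MathematicalPhysics.QuantumFieldTheory.Balaban1983to89.B9Thm311Data
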